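import Literature.AlgebraicTopology.Homotopy.WeakHomotopyEquivalence
import Literature.AlgebraicTopology.Homotopy.HomotopyGroupsGeneralPosition
import Literature.AlgebraicTopology.FundamentalGroup.SphereSimplyConnected
import Literature.AlgebraicTopology.SingularHomology.HurewiczEilenberg
import Literature.AlgebraicTopology.SingularHomology.SphereHomology
import Mathlib.Algebra.Group.ULift
import HarnessLib

/-!
# Loops in topological groups, `πₘ(Sᵐ) ≅ ℤ`, and essential maps of spheres

Topic `Literature/Topology/FourManifolds`; first of three sibling files
(`…Loops`, `…Boundary`, `…Even`) continuing
`HomotopySpheresStablyParallelizableStability.lean` / `…Seven.lean` towards the named fact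
`Literature.Topology.FourManifolds.Bott1959_sphereMapsToStableFramesExtend_six` (Bott 1959:
`π₆(SO) = 0`; in the tree `↔ π₆(SO(8), 1) = 0`, `⇐ π₆(SO(7), 1) = 0`). The three files prove
N. Steenrod, *The Topology of Fibre Bundles* (1951), §23.4 in the even case — for `D` even the
projection `p : SO(D + 1) → Sᴰ` is zero on `π_D`, so that `π_D(SO(D), 1) → π_D(SO(D + 1), 1)` is
onto — and hence reduce the fact one step further, to `π₆(SO(6), 1) = 0`. This file collects the
general homotopy-group bookkeeping the argument needs, all PROVED (Mathlib's cubical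
`HomotopyGroup N X x`, classes `cls p = ⟦p⟧` of `Ω^ N X x` rel `∂Iᴺ`, §0):

* §1 **Loops in a topological group** (Eckmann–Hilton; folklore: in a topological group, or an
  H-space, the product of `πₙ` can be computed pointwise — Hatcher, *Algebraic Topology* (2002),
  §3.C, Example 3C.4 for the argument): for `p, q ∈ Ω^ N G 1` the pointwise product `mulLoop p q` represents `⟦p⟧ * ⟦q⟧`
  (`cls_mulLoop`), pointwise inverses and powers represent inverses and powers (`cls_invLoop`,
  `cls_powLoop`, `cls_zpowLoop`).
* §2 **Post-composition with a base-point preserving self-map** `F : X → X`, `F x = x`: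
  `postLoop`, the induced endomorphism `postHom F hF : π_N(X, x) →* π_N(X, x)` (Hatcher §4.1
  p. 342), and its interaction with `symmAt`.
* §3 **Infinite cyclic groups**: an endomorphism of a group `≃* ℤ` that inverts one non-trivial
  element inverts every element (`map_eq_inv_of_map_eq_inv`).
* §4 **`πₘ(Sᵐ, x) ≃* ℤ` for `m ≥ 2`** (`nonempty_mulEquiv_homotopyGroup_sphere_int`,
  `nontrivial_homotopyGroup_sphere`), assembled from the tree's Hurewicz isomorphism
  (`hurewicz_iso_of_collapseDevice`, Hatcher Thm. 4.32), `Hₘ(Sᵐ; ℤ) ≅ ℤ`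
  (`nonempty_singularHomology_sphere_iso_holds`, Hatcher Cor. 2.14), `π_k(Sᵐ) = 0` for `k < m`
  (`subsingleton_homotopyGroup_sphere`, Cor. 4.9) and `π₁(Sᵐ) = 0` (Prop. 1.14).
* §5 **Relative homeomorphisms are essential** (`cls_ne_one_of_surjective`): if
  `c : (Iᴺ, ∂Iᴺ) → (X, x)` is onto and identifies only boundary points, and `π_N(X, x)` is
  non-trivial, then `⟦c⟧ ≠ 1` — for a null-homotopy of `c` rel `∂Iᴺ` would descend through the
  quotient map `c` (compact to Hausdorff) to a null-homotopy of `𝟙_X` rel `x`, making `π_N(X, x)`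
  trivial (Hatcher §4.1 p. 340: `πₙ(X, x₀)` as classes of maps `(Iⁿ/∂Iⁿ, ∂Iⁿ/∂Iⁿ) → (X, x₀)`).

No definitions of mathematical content beyond the three loop operations and `postLoop`/`postHom`;
no named facts.

## References

* N. Steenrod, *The Topology of Fibre Bundles*, Princeton (1951), §23.4. [Steenrod1951]
* A. Hatcher, *Algebraic Topology*, CUP (2002), §4.1 pp. 340–342, Thm. 4.32, Cor. 2.14, Cor. 4.9.
  [HatcherAT2002]
* R. Bott, *The stable homotopy of the classical groups*, Ann. of Math. 70 (1959), 313–337, §1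
  (1.5). [Bott1959]
-/

noncomputable section

open scoped unitInterval Topology.Homotopy
open Literature.AlgebraicTopology.Homotopy

namespace Literature.Topology.FourManifolds

namespace EvenSphere

/-! ### 0. Classes of loops, with their `HomotopyGroup` type -/

section Cls

variable {X : Type*} [TopologicalSpace X] {x : X} {N : Type*}

/-- The class `⟦p⟧ ∈ π_N(X, x)` of a based loop, typed as an element of `HomotopyGroup N X x`
(Mathlib's `⟦p⟧` is typed as a bare quotient, which hides the group structure from the
elaborator; compare the phrasing of `HomotopyGroup.mul_spec`). [folklore] -/
abbrev cls (p : Ω^ N X x) : HomotopyGroup N X x := ⟦p⟧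

/-- Two loops have the same class iff they are homotopic rel `∂Iᴺ`. [folklore] -/
theorem cls_eq_cls_iff {p q : Ω^ N X x} : cls p = cls q ↔ GenLoop.Homotopic p q :=
  ⟨fun h => Quotient.exact h, fun h => Quotient.sound h⟩

variable [DecidableEq N]

/-- `1 = ⟦const⟧` (`HomotopyGroup.one_def`). [folklore] -/
theorem one_eq_cls_const [Nonempty N] : (1 : HomotopyGroup N X x) = cls GenLoop.const :=
  HomotopyGroup.one_def

/-- `⟦p⟧ * ⟦q⟧ = ⟦q ∗ᵢ p⟧` (`HomotopyGroup.mul_spec`). [folklore] -/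
theorem cls_mul_cls [Nonempty N] (i : N) (p q : Ω^ N X x) :
    cls p * cls q = cls (GenLoop.transAt i q p) :=
  HomotopyGroup.mul_spec

/-- `⟦p⟧⁻¹ = ⟦p reversed along i⟧` (`HomotopyGroup.inv_spec`). [folklore] -/
theorem cls_inv [Nonempty N] (i : N) (p : Ω^ N X x) : (cls p)⁻¹ = cls (GenLoop.symmAt i p) :=
  HomotopyGroup.inv_spec

/-- `⟦p⟧ = 1` iff `p` is null-homotopic rel `∂Iᴺ`. [folklore] -/
theorem cls_eq_one_iff [Nonempty N] {p : Ω^ N X x} :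
    cls p = 1 ↔ GenLoop.Homotopic p GenLoop.const := by
  rw [one_eq_cls_const, cls_eq_cls_iff]

omit [DecidableEq N] in
/-- The tree's induced map `f_*` on classes: `f_* ⟦p⟧ = ⟦f ∘ p⟧`. [folklore] -/
theorem homotopyGroupMap_cls {Y : Type*} [TopologicalSpace Y] (f : C(X, Y)) (p : Ω^ N X x) :
    homotopyGroupMap f x (cls p) = cls (genLoopMap f x p) := rfl

end Cls

/-! ### 1. Loops in a topological group: pointwise operations (Eckmann–Hilton) -/

section Group

variable {G : Type*} [TopologicalSpace G] [Group G] [IsTopologicalGroup G] {N : Type*}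

/-- The pointwise product of two based loops `(Iᴺ, ∂Iᴺ) → (G, 1)`. [folklore] -/
def mulLoop (p q : Ω^ N G (1 : G)) : Ω^ N G (1 : G) :=
  ⟨⟨fun y => p y * q y, p.1.continuous.mul q.1.continuous⟩, fun y hy => by
    simp [GenLoop.boundary p y hy, GenLoop.boundary q y hy]⟩

/-- The pointwise inverse of a based loop `(Iᴺ, ∂Iᴺ) → (G, 1)`. [folklore] -/
def invLoop (p : Ω^ N G (1 : G)) : Ω^ N G (1 : G) :=
  ⟨⟨fun y => (p y)⁻¹, p.1.continuous.inv⟩, fun y hy => by simp [GenLoop.boundary p y hy]⟩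

/-- The pointwise `k`-th power of a based loop `(Iᴺ, ∂Iᴺ) → (G, 1)`. [folklore] -/
def powLoop (p : Ω^ N G (1 : G)) (k : ℕ) : Ω^ N G (1 : G) :=
  ⟨⟨fun y => p y ^ k, p.1.continuous.pow k⟩, fun y hy => by simp [GenLoop.boundary p y hy]⟩

/-- The pointwise integer power of a based loop `(Iᴺ, ∂Iᴺ) → (G, 1)`. [folklore] -/
def zpowLoop (p : Ω^ N G (1 : G)) (k : ℤ) : Ω^ N G (1 : G) :=
  ⟨⟨fun y => p y ^ k, p.1.continuous.zpow k⟩, fun y hy => by simp [GenLoop.boundary p y hy]⟩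

/-- `mulLoop` pointwise. [folklore] -/
@[simp] theorem mulLoop_apply (p q : Ω^ N G (1 : G)) (y : N → I) :
    mulLoop p q y = p y * q y := rfl

/-- `invLoop` pointwise. [folklore] -/
@[simp] theorem invLoop_apply (p : Ω^ N G (1 : G)) (y : N → I) : invLoop p y = (p y)⁻¹ := rfl

/-- `powLoop` pointwise. [folklore] -/
@[simp] theorem powLoop_apply (p : Ω^ N G (1 : G)) (k : ℕ) (y : N → I) :
    powLoop p k y = p y ^ k := rfl

/-- `zpowLoop` pointwise. [folklore] -/
@[simp] theorem zpowLoop_apply (p : Ω^ N G (1 : G)) (k : ℤ) (y : N → I) :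
    zpowLoop p k y = p y ^ k := rfl

variable [DecidableEq N]

/-- **Eckmann–Hilton for topological groups**: the pointwise product of two based loops
represents the product of their classes in `π_N(G, 1)`. *Proof.* `p ≃ 1·p` ("constant, then `p`")
and `q ≃ q·1` rel `∂Iᴺ` (the unit laws of `π_N`); multiplying the two homotopies pointwise joins
`p q` to the concatenation of `q` and `p`, which represents `⟦p⟧ * ⟦q⟧`. [folklore] -/
theorem cls_mulLoop [Nonempty N] (p q : Ω^ N G (1 : G)) :
    cls (mulLoop p q) = cls p * cls q := by
  obtain ⟨i⟩ := ‹Nonempty N›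
  have hp : GenLoop.Homotopic p (GenLoop.transAt i GenLoop.const p) := by
    rw [← cls_eq_cls_iff, ← cls_mul_cls, ← one_eq_cls_const, mul_one]
  have hq : GenLoop.Homotopic q (GenLoop.transAt i q GenLoop.const) := by
    rw [← cls_eq_cls_iff, ← cls_mul_cls, ← one_eq_cls_const, one_mul]
  obtain ⟨Hp⟩ := hp
  obtain ⟨Hq⟩ := hq
  rw [cls_mul_cls i, cls_eq_cls_iff]
  refine ⟨{ toFun := fun z => Hp z * Hq z
            continuous_toFun := Hp.continuous.mul Hq.continuous
            map_zero_left := fun y => ?_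
            map_one_left := fun y => ?_
            prop' := fun t y hy => ?_ }⟩
  · rw [Hp.apply_zero, Hq.apply_zero]
    rfl
  · rw [Hp.apply_one, Hq.apply_one]
    change GenLoop.transAt i GenLoop.const p y * GenLoop.transAt i q GenLoop.const y =
      GenLoop.transAt i q p y
    simp only [GenLoop.transAt, GenLoop.coe_copy]
    split_ifs <;> simp
  · change Hp (t, y) * Hq (t, y) = mulLoop p q y
    rw [Hp.eq_fst t hy, Hq.eq_fst t hy]
    rfl

/-- The pointwise inverse represents the inverse class. [folklore] -/
theorem cls_invLoop [Nonempty N] (p : Ω^ N G (1 : G)) : cls (invLoop p) = (cls p)⁻¹ := by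
  have h : mulLoop p (invLoop p) = GenLoop.const := GenLoop.ext _ _ fun y => by simp
  have h1 : cls p * cls (invLoop p) = 1 := by
    rw [← cls_mulLoop, h, one_eq_cls_const]
  exact (eq_inv_of_mul_eq_one_right h1)

/-- The pointwise `k`-th power represents the `k`-th power of the class. [folklore] -/
theorem cls_powLoop [Nonempty N] (p : Ω^ N G (1 : G)) (k : ℕ) : cls (powLoop p k) = cls p ^ k := by
  induction k with
  | zero =>
    have h : powLoop p 0 = GenLoop.const := GenLoop.ext _ _ fun y => by simp
    rw [h, pow_zero, one_eq_cls_const]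
  | succ k ih =>
    have h : powLoop p (k + 1) = mulLoop (powLoop p k) p :=
      GenLoop.ext _ _ fun y => by simp [pow_succ]
    rw [h, cls_mulLoop, ih, pow_succ]

/-- The pointwise integer power represents the integer power of the class. [folklore] -/
theorem cls_zpowLoop [Nonempty N] (p : Ω^ N G (1 : G)) (k : ℤ) :
    cls (zpowLoop p k) = cls p ^ k := by
  cases k with
  | ofNat k =>
    have h : zpowLoop p (Int.ofNat k) = powLoop p k := GenLoop.ext _ _ fun y => by simp
    rw [h, cls_powLoop, Int.ofNat_eq_natCast, zpow_natCast]
  | negSucc k =>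
    have h : zpowLoop p (Int.negSucc k) = invLoop (powLoop p (k + 1)) :=
      GenLoop.ext _ _ fun y => by simp [zpow_negSucc]
    rw [h, cls_invLoop, cls_powLoop, zpow_negSucc]

/-- The pointwise product with a loop which is null-homotopic rel `∂Iᴺ` does not change the
class. [folklore] -/
theorem cls_mulLoop_of_homotopic_const [Nonempty N] (p q : Ω^ N G (1 : G))
    (hq : GenLoop.Homotopic q GenLoop.const) : cls (mulLoop p q) = cls p := by
  rw [cls_mulLoop, cls_eq_cls_iff.mpr hq, ← one_eq_cls_const, mul_one]

end Group

/-! ### 2. Post-composition with a base-point preserving self-map -/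

section Post

variable {X : Type*} [TopologicalSpace X] {x : X} {N : Type*}

/-- `F ∘ p` for a based loop `p` at `x` and a self-map `F` of `X` with `F x = x` (Hatcher 2002,
§4.1 p. 342, `φ f`, same base point). [cite: HatcherAT2002, §4.1 p. 342] -/
def postLoop (F : C(X, X)) (hF : F x = x) (p : Ω^ N X x) : Ω^ N X x :=
  ⟨F.comp p.1, fun y hy => by
    change F (p y) = x
    rw [GenLoop.boundary p y hy, hF]⟩

/-- `postLoop` pointwise. [folklore] -/
@[simp] theorem postLoop_apply (F : C(X, X)) (hF : F x = x) (p : Ω^ N X x) (y : N → I) :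
    postLoop F hF p y = F (p y) := rfl

/-- Post-composition preserves homotopy rel `∂Iᴺ`. [folklore] -/
theorem postLoop_homotopic (F : C(X, X)) (hF : F x = x) {p q : Ω^ N X x}
    (h : GenLoop.Homotopic p q) : GenLoop.Homotopic (postLoop F hF p) (postLoop F hF q) :=
  ContinuousMap.HomotopicRel.comp_continuousMap h F

/-- Post-composition by a composite. [folklore] -/
theorem postLoop_comp (F F' : C(X, X)) (hF : F x = x) (hF' : F' x = x) (p : Ω^ N X x) :
    postLoop (F.comp F') (by change F (F' x) = x; rw [hF', hF]) p =
      postLoop F hF (postLoop F' hF' p) :=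
  GenLoop.ext _ _ fun _ => rfl

/-- Post-composition by (a map equal to) the identity. [folklore] -/
theorem postLoop_eq_self_of (F : C(X, X)) (hF : F x = x) (hid : ∀ z, F z = z) (p : Ω^ N X x) :
    postLoop F hF p = p :=
  GenLoop.ext _ _ fun y => hid (p y)

variable [DecidableEq N]

/-- Post-composition commutes with reversal along a coordinate. [folklore] -/
theorem postLoop_symmAt (F : C(X, X)) (hF : F x = x) (j : N) (p : Ω^ N X x) :
    postLoop F hF (GenLoop.symmAt j p) = GenLoop.symmAt j (postLoop F hF p) :=
  GenLoop.ext _ _ fun _ => rfl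

/-- Post-composition commutes with concatenation along a coordinate. [folklore] -/
theorem postLoop_transAt (F : C(X, X)) (hF : F x = x) (j : N) (p q : Ω^ N X x) :
    postLoop F hF (GenLoop.transAt j p q) =
      GenLoop.transAt j (postLoop F hF p) (postLoop F hF q) := by
  ext t
  simp only [postLoop_apply, GenLoop.transAt, GenLoop.coe_copy]
  split_ifs <;> rfl

/-- **The induced endomorphism `F_* : π_N(X, x) → π_N(X, x)`** of a self-map fixing the base
point (Hatcher 2002, §4.1 p. 342), as a function. [cite: HatcherAT2002, §4.1 p. 342] -/
def postMap (F : C(X, X)) (hF : F x = x) : HomotopyGroup N X x → HomotopyGroup N X x :=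
  Quotient.map (postLoop F hF) fun _ _ h => postLoop_homotopic F hF h

omit [DecidableEq N] in
/-- `F_* ⟦p⟧ = ⟦F ∘ p⟧`. [folklore] -/
@[simp] theorem postMap_cls (F : C(X, X)) (hF : F x = x) (p : Ω^ N X x) :
    postMap F hF (cls p) = cls (postLoop F hF p) := rfl

/-- `F_*` is multiplicative (Hatcher 2002, p. 342). [cite: HatcherAT2002, §4.1 p. 342] -/
theorem postMap_mul [Nonempty N] (F : C(X, X)) (hF : F x = x) (a b : HomotopyGroup N X x) :
    postMap F hF (a * b) = postMap F hF a * postMap F hF b := by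
  obtain ⟨i⟩ := ‹Nonempty N›
  induction a using Quotient.inductionOn with
  | h p =>
    induction b using Quotient.inductionOn with
    | h q =>
      change postMap F hF (cls p * cls q) = postMap F hF (cls p) * postMap F hF (cls q)
      rw [cls_mul_cls i, postMap_cls, postMap_cls, postMap_cls, cls_mul_cls i, postLoop_transAt]

/-- **The induced endomorphism `F_* : π_N(X, x) →* π_N(X, x)`** as a homomorphism (`N`
nonempty). [cite: HatcherAT2002, §4.1 p. 342] -/
def postHom [Nonempty N] (F : C(X, X)) (hF : F x = x) : HomotopyGroup N X x →* HomotopyGroup N X x :=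
  MonoidHom.mk' (postMap F hF) (postMap_mul F hF)

/-- `F_* ⟦p⟧ = ⟦F ∘ p⟧`. [folklore] -/
@[simp] theorem postHom_cls [Nonempty N] (F : C(X, X)) (hF : F x = x) (p : Ω^ N X x) :
    postHom F hF (cls p) = cls (postLoop F hF p) := rfl

/-- If `F ∘ p = p ∘ (reversal of the `j`-th coordinate)` then `F_*⟦p⟧ = ⟦p⟧⁻¹`. [folklore] -/
theorem postHom_cls_eq_inv_of_eq_symmAt [Nonempty N] (F : C(X, X)) (hF : F x = x) (j : N)
    (p : Ω^ N X x) (h : postLoop F hF p = GenLoop.symmAt j p) :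
    postHom F hF (cls p) = (cls p)⁻¹ := by
  rw [postHom_cls, h, ← cls_inv]

end Post

/-! ### 3. Endomorphisms of an infinite cyclic group -/

section Cyclic

variable {Γ : Type*} [Group Γ]

/-- In a group isomorphic to `ℤ`, every element is an integer power of the preimage of `1`.
[folklore] -/
theorem eq_zpow_of_mulEquiv_int (e : Γ ≃* Multiplicative ℤ) (v : Γ) :
    v = e.symm (Multiplicative.ofAdd 1) ^ (Multiplicative.toAdd (e v)) := by
  apply e.injective
  rw [map_zpow, e.apply_symm_apply, ← ofAdd_zsmul, smul_eq_mul, mul_one, ofAdd_toAdd]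

/-- **An endomorphism of an infinite cyclic group inverting one non-trivial element inverts every
element** (`α = ·ᵈ` with `d u = -u`, `u ≠ 0`, forces `d = -1`). [folklore] -/
theorem map_eq_inv_of_map_eq_inv (e : Γ ≃* Multiplicative ℤ) (α : Γ →* Γ) {u : Γ} (hu : u ≠ 1)
    (hα : α u = u⁻¹) (v : Γ) : α v = v⁻¹ := by
  set g : Γ := e.symm (Multiplicative.ofAdd 1) with hg
  set d : ℤ := Multiplicative.toAdd (e (α g)) with hd
  have key : ∀ w : Γ, Multiplicative.toAdd (e (α w)) = Multiplicative.toAdd (e w) * d := by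
    intro w
    conv_lhs => rw [eq_zpow_of_mulEquiv_int e w]
    rw [map_zpow α, map_zpow e, toAdd_zpow, smul_eq_mul]
  have hu' : Multiplicative.toAdd (e u) ≠ 0 := by
    intro h0
    apply hu
    apply e.injective
    apply Multiplicative.toAdd.injective
    rw [h0, map_one, toAdd_one]
  have hd1 : d = -1 := by
    have h := key u
    rw [hα, map_inv e, toAdd_inv] at h
    have : Multiplicative.toAdd (e u) * (d + 1) = 0 := by linear_combination -h
    rcases mul_eq_zero.mp this with h0 | h0
    · exact absurd h0 hu'
    · linear_combination h0
  apply e.injective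
  apply Multiplicative.toAdd.injective
  rw [key v, hd1, map_inv e, toAdd_inv, mul_neg_one]

/-- In a group isomorphic to `ℤ`, two elements have a common power relation:
`v ^ (e u) = u ^ (e v)`. [folklore] -/
theorem zpow_toAdd_eq_zpow_toAdd (e : Γ ≃* Multiplicative ℤ) (u v : Γ) :
    v ^ (Multiplicative.toAdd (e u)) = u ^ (Multiplicative.toAdd (e v)) := by
  apply e.injective
  apply Multiplicative.toAdd.injective
  rw [map_zpow e, map_zpow e, toAdd_zpow, toAdd_zpow, smul_eq_mul, smul_eq_mul, mul_comm]

/-- In a group isomorphic to `ℤ`: if `u ^ k = 1` with `u ≠ 1` then `k = 0`. [folklore] -/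
theorem eq_zero_of_zpow_eq_one (e : Γ ≃* Multiplicative ℤ) {u : Γ} (hu : u ≠ 1) {k : ℤ}
    (hk : u ^ k = 1) : k = 0 := by
  have h := congrArg (fun w => Multiplicative.toAdd (e w)) hk
  rw [map_zpow e, toAdd_zpow, smul_eq_mul, map_one, toAdd_one] at h
  rcases mul_eq_zero.mp h with h0 | h0
  · exact h0
  · exfalso
    apply hu
    apply e.injective
    apply Multiplicative.toAdd.injective
    rw [h0, map_one, toAdd_one]

end Cyclic

/-! ### 4. `πₘ(Sᵐ, x) ≅ ℤ` for `m ≥ 2` -/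

section Sphere

open Literature.AlgebraicTopology.SingularHomology Literature.AlgebraicTopology.FundamentalGroup

/-- **`πₘ(Sᵐ, x) ≅ ℤ` for `m ≥ 2`** (Hatcher, *Algebraic Topology* (2002), Cor. 4.25), at every
base point of the unit sphere of `ℝᵐ⁺¹`, as an abstract isomorphism of groups: the Hurewicz
isomorphism `πₘ(Sᵐ) ≅ Hₘ(Sᵐ; ℤ)` (Thm. 4.32, the tree's `hurewicz_iso_of_collapseDevice`; `Sᵐ`
is simply connected, Prop. 1.14, with `π_k(Sᵐ) = 0` for `k < m`, Cor. 4.9) composed with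
`Hₘ(Sᵐ; ℤ) ≅ ℤ` (Cor. 2.14, `nonempty_singularHomology_sphere_iso_holds`).
[cite: HatcherAT2002, Cor. 4.25 with Thm. 4.32 and Cor. 2.14] -/
theorem nonempty_mulEquiv_homotopyGroup_sphere_int {m : ℕ} [NeZero m] (hm : 2 ≤ m)
    (x : Metric.sphere (0 : EuclideanSpace ℝ (Fin (m + 1))) 1) :
    Nonempty (HomotopyGroup (Fin m) (Metric.sphere (0 : EuclideanSpace ℝ (Fin (m + 1))) 1) x ≃*
      Multiplicative ℤ) := by
  haveI := simplyConnectedSpace_euclideanSphere m hm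
  obtain ⟨e₁⟩ := hurewicz_iso_of_collapseDevice
    (Metric.sphere (0 : EuclideanSpace ℝ (Fin (m + 1))) 1) m hm
    (fun k _ hkm y => subsingleton_homotopyGroup_sphere
      (by rw [finrank_euclideanSpace_fin]; omega) y) x
  obtain ⟨e₂⟩ := nonempty_singularHomology_sphere_iso_holds ℤ ℤ (n := m) (by omega)
  exact ⟨e₁.trans (AddEquiv.toMultiplicative
    (e₂.toLinearEquiv.toAddEquiv.trans (AddEquiv.ulift (α := ℤ))))⟩

/-- `πₘ(Sᵐ, x)` is non-trivial for `m ≥ 2`. [cite: HatcherAT2002, Cor. 4.25] -/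
theorem nontrivial_homotopyGroup_sphere {m : ℕ} [NeZero m] (hm : 2 ≤ m)
    (x : Metric.sphere (0 : EuclideanSpace ℝ (Fin (m + 1))) 1) :
    Nontrivial (HomotopyGroup (Fin m) (Metric.sphere (0 : EuclideanSpace ℝ (Fin (m + 1))) 1) x) := by
  obtain ⟨e⟩ := nonempty_mulEquiv_homotopyGroup_sphere_int hm x
  exact e.toEquiv.nontrivial

end Sphere

/-! ### 5. Relative homeomorphisms `(Iᴺ, ∂Iᴺ) → (X, x)` are essential -/

section Essential

variable {X : Type*} [TopologicalSpace X] {x : X} {N : Type*}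

/-- **A based cube map which is onto and identifies only boundary points is essential** whenever
`π_N(X, x) ≠ 0`. *Proof.* If `c ≃ const` rel `∂Iᴺ` by `H`, then `H̄(t, c y) := H(t, y)` is well
defined and continuous on `I × X` (`𝟙 × c` is a closed surjection from a compact space onto a
Hausdorff one, hence a quotient map); `H̄` deforms `𝟙_X` to the constant map keeping `x` fixed,
so `H̄ ∘ (𝟙 × γ)` contracts every based loop `γ` rel `∂Iᴺ` and `π_N(X, x)` would be trivial
(Hatcher 2002, §4.1 p. 340: `πₙ(X, x₀) = [(Iⁿ/∂Iⁿ, ∗), (X, x₀)]`). [cite: HatcherAT2002, §4.1 p. 340] -/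
theorem cls_ne_one_of_surjective [T2Space X] [DecidableEq N] [Nonempty N] (c : Ω^ N X x)
    (hs : Function.Surjective c)
    (hi : ∀ y y', c y = c y' → y = y' ∨ (y ∈ Cube.boundary N ∧ y' ∈ Cube.boundary N))
    (hX : Nontrivial (HomotopyGroup N X x)) : cls c ≠ 1 := by
  intro h
  obtain ⟨H⟩ : GenLoop.Homotopic c GenLoop.const := cls_eq_one_iff.mp h
  choose g hg using hs
  obtain ⟨i⟩ := ‹Nonempty N›
  -- a boundary point, and: points over `x` are boundary points
  have hb0 : (fun _ => 0 : N → I) ∈ Cube.boundary N := ⟨i, Or.inl rfl⟩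
  have hcx : ∀ y, c y = x → y ∈ Cube.boundary N := fun y hy => by
    rcases hi y (fun _ => 0) (hy.trans (GenLoop.boundary c _ hb0).symm) with h' | ⟨h', -⟩
    · rw [h']; exact hb0
    · exact h'
  -- `H` is constant on the fibres of `c`
  have key : ∀ t y, H (t, g (c y)) = H (t, y) := fun t y => by
    rcases hi (g (c y)) y (hg (c y)) with h' | ⟨h1, h2⟩
    · rw [h']
    · rw [H.eq_fst t h1, H.eq_fst t h2]
      exact hg (c y)
  -- `(t, y) ↦ (t, c y)` is a quotient map
  let q : I × (N → I) → I × X := fun z => (z.1, c z.2)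
  have hqc : Continuous q := continuous_fst.prodMk (c.1.continuous.comp continuous_snd)
  have hq : Topology.IsQuotientMap q :=
    (hqc.isClosedMap).isQuotientMap hqc fun z => ⟨(z.1, g z.2), Prod.ext rfl (hg z.2)⟩
  -- the descended null-homotopy of the identity
  have hHc : Continuous fun z : I × X => H (z.1, g z.2) := by
    rw [hq.continuous_iff]
    have : (fun z : I × X => H (z.1, g z.2)) ∘ q = fun z => H z := by
      funext z
      exact key z.1 z.2
    rw [this]
    exact H.continuous
  -- every based loop is null-homotopic rel `∂Iᴺ`
  have hall : ∀ γ : Ω^ N X x, GenLoop.Homotopic γ GenLoop.const := fun γ =>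
    ⟨{ toFun := fun z => H (z.1, g (γ z.2))
       continuous_toFun := hHc.comp (continuous_fst.prodMk (γ.1.continuous.comp continuous_snd))
       map_zero_left := fun y => by
         change H (0, g (γ y)) = γ y
         rw [H.apply_zero]
         exact hg (γ y)
       map_one_left := fun y => by
         change H (1, g (γ y)) = x
         rw [H.apply_one]
         rfl
       prop' := fun t y hy => by
         change H (t, g (γ y)) = γ y
         rw [GenLoop.boundary γ y hy, H.eq_fst t (hcx _ (hg x))]
         exact hg x }⟩
  have hsub : Subsingleton (HomotopyGroup N X x) := subsingleton_homotopyGroup_iff.mpr hall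
  exact false_of_nontrivial_of_subsingleton (HomotopyGroup N X x)

end Essential

end EvenSphere

end Literature.Topology.FourManifolds

end
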